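import Summits.BirchSwinnertonDyer.BirchSwinnertonDyer.Theorems.SignedLowerHalvesSmallImageMuZeroOneSignFinePivotLengths
import Literature.NumberTheory.EllipticCurves.IwasawaDualFunctorialityProofs
import HarnessLib

/-!
# Route `SignedLowerHalves` (K3), crux M `SmallImageMuZeroOneSign` (item stmt-BirchSwinnertonDyer-23600), line `birth_mu` —
# the FINE PIVOT, part 2: the RESIDUAL DICHOTOMY for two sub-pairs of a Pontryagin dual pair over `Λ`

LEAD seat `cruxlead-stmt-BirchSwinnertonDyer-23600` gen 2 (cell `bsd-ssimc`; helper file, `--supports stmt-BirchSwinnertonDyer-23600`;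
theorems only).  Over the tree's axiomatic Pontryagin duality `IwasawaDual.IsDualPair` (a `Λ`-module `X`, a `p`-primary group `S`
with `ψ = γ − 1`, `toDual : X ≃ Hom(S, ℚ/ℤ)`): if `(XA, SA)` and `(XB, SB)` are dual pairs mapping INTO `(X, S)` by injective
equivariant `φA`, `φB`, the residual corank of `S` is at most one (`ℓ_𝔭(X/pX) ≤ 1`, `𝔭 = (p)`) and the `p`-torsion of
`φA(SA) ∩ φB(SB)` is finite, then `ℓ_𝔭(XA) = 0` or `ℓ_𝔭(XB) = 0` (`lengthAt_eq_zero_or_of_residual`).  Ingredients: (E1) the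
annihilator of `A ∩ B` is `ann A + ann B` and (E2) a character killing `C[p]` is `p` times a character — both by extending characters
along injections (`ℚ/ℤ` injective, Mathlib `CharacterModule.dual_surjective_of_injective`) — and the count
`ℓ(X/U') + ℓ(X/V') = ℓ(X/(U' ⊓ V')) + ℓ(X/(U' ⊔ V')) ≤ 1 + 0`, `U' = ann A + pX`, `V' = ann B + pX`.  Also: `S[p]` finite ⟺-type
transfers (`finite_quot_augIdealP_of_finite_pTorsion`, `finite_pTorsion_of_moduleFinite_padicInt`, `finite_pTorsion_of_lengthAt_eq_zero`).
HONEST FRAMING: pure algebra; nothing about any curve is asserted; crux M, crux 4 and BSD are NOT proved by this file.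
Applied in part 3 to `S = Sel_{p^∞}(E/ℚ_∞) ⊇ Sel⁺, Sel⁻` (Kobayashi), where Conjecture A and Wingberg/Matar give the two hypotheses.

References: [GreenbergLNM1716] §1 p. 60 (Pontryagin duals as `Λ`-modules); [Lang1990] Ch. 5 §1; [LimSujatha2018] §3;
[Washington1997] §13.2; crux idea card «fine-pivot-minsign» ADDENDUM v1.1 (B) (bsd-idea-5 g10) for the residual count.
-/

set_option autoImplicit false
set_option linter.dupNamespace false

noncomputable section

open scoped Classical

namespace Summit.BirchSwinnertonDyer.BirchSwinnertonDyer.Theorems.SmallImageFinePivot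

open Literature.NumberTheory.EllipticCurves Literature.NumberTheory.EllipticCurves.Module
  Literature.NumberTheory.EllipticCurves.IwasawaAlgebra Literature.NumberTheory.EllipticCurves.IwasawaDual

/-! ### §5 The residual dichotomy for two sub-pairs of a dual pair -/

section Dichotomy

variable {p : ℕ} [Fact p.Prime]

/-- Character extension along an injection (`ℚ/ℤ` is an injective `ℤ`-module). [folklore] -/
theorem exists_character_extend {A B : Type*} [AddCommGroup A] [AddCommGroup B] (f : A →+ B)
    (hf : Function.Injective f) (χ : A →+ AddCircle (1 : ℚ)) :
    ∃ Θ : B →+ AddCircle (1 : ℚ), ∀ a, Θ (f a) = χ a := by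
  obtain ⟨Θ, hΘ⟩ := CharacterModule.dual_surjective_of_injective (R := ℤ) f.toIntLinearMap hf χ
  exact ⟨Θ, fun a ↦ congrArg (fun c : CharacterModule A ↦ c a) hΘ⟩

variable {S : Type*} [AddCommGroup S] {ψ : AddMonoid.End S}
  {X : Type*} [AddCommGroup X] [Module (PowerSeries ℤ_[p]) X] {toDual : X →+ (S →+ AddCircle (1 : ℚ))}
  {SA : Type*} [AddCommGroup SA] {ψA : AddMonoid.End SA}
  {XA : Type*} [AddCommGroup XA] [Module (PowerSeries ℤ_[p]) XA] {toDualA : XA →+ (SA →+ AddCircle (1 : ℚ))}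
  {SB : Type*} [AddCommGroup SB] {ψB : AddMonoid.End SB}
  {XB : Type*} [AddCommGroup XB] [Module (PowerSeries ℤ_[p]) XB] {toDualB : XB →+ (SB →+ AddCircle (1 : ℚ))}

/-- The kernel of the transpose `π : X ↠ X'` of an injection `φ : S' ↪ S` is the annihilator of `φ(S')`. [folklore] -/
theorem mem_ker_transpose_iff (hA : IsDualPair p ψA toDualA) {φ : SA →+ S} {π : X →ₗ[PowerSeries ℤ_[p]] XA}
    (hπ : ∀ (x : X) (a : SA), toDualA (π x) a = toDual x (φ a)) (x : X) :
    x ∈ LinearMap.ker π ↔ ∀ a : SA, toDual x (φ a) = 0 := by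
  rw [LinearMap.mem_ker, ← map_eq_zero_iff (f := toDualA) hA.bijective.1, AddMonoidHom.ext_iff]
  simp only [hπ, AddMonoidHom.zero_apply]

/-- **(E1) The annihilator of `A ∩ B` is `ann(A) + ann(B)`**: if `toDual x` kills `φA(SA) ∩ φB(SB)` then
`x ∈ ker πA ⊔ ker πB` — split the character `toDual x` as `Θ + (toDual x − Θ)` with `Θ` extending the
character `(a, b) ↦ toDual x (φB b)` of `(SA × SB)/{(a, b) : φA a + φB b = 0} ↪ S`. [folklore] -/
theorem mem_sup_ker_of_forall_inf (hS : IsDualPair p ψ toDual) (hA : IsDualPair p ψA toDualA)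
    (hB : IsDualPair p ψB toDualB) {φA : SA →+ S} {φB : SB →+ S}
    {πA : X →ₗ[PowerSeries ℤ_[p]] XA} (hπA : ∀ (x : X) (a : SA), toDualA (πA x) a = toDual x (φA a))
    {πB : X →ₗ[PowerSeries ℤ_[p]] XB} (hπB : ∀ (x : X) (b : SB), toDualB (πB x) b = toDual x (φB b))
    (x : X) (hx : ∀ s : S, s ∈ φA.range → s ∈ φB.range → toDual x s = 0) :
    x ∈ LinearMap.ker πA ⊔ LinearMap.ker πB := by
  -- `Ψ : SA × SB → S`, `(a, b) ↦ φA a + φB b`; `θ' (a, b) = toDual x (φB b)` kills `ker Ψ`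
  let Ψ : SA × SB →+ S := φA.coprod φB
  let θ' : SA × SB →+ AddCircle (1 : ℚ) := (toDual x).comp (φB.comp (AddMonoidHom.snd SA SB))
  have hθ' : Ψ.ker ≤ θ'.ker := by
    rintro ⟨a, b⟩ hab
    rw [AddMonoidHom.mem_ker] at hab ⊢
    change φA a + φB b = 0 at hab
    change toDual x (φB b) = 0
    have hb : φB b = -φA a := eq_neg_of_add_eq_zero_right hab
    have h1 : φB b ∈ φA.range := by rw [hb]; exact neg_mem ⟨a, rfl⟩
    exact hx _ h1 ⟨b, rfl⟩
  let θ'' : (SA × SB) ⧸ Ψ.ker →+ AddCircle (1 : ℚ) := QuotientAddGroup.lift Ψ.ker θ' hθ'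
  obtain ⟨Θ, hΘ⟩ := exists_character_extend (QuotientAddGroup.kerLift Ψ) (QuotientAddGroup.kerLift_injective Ψ) θ''
  have hΘA : ∀ a, Θ (φA a) = 0 := by
    intro a
    have := hΘ (QuotientAddGroup.mk (a, 0))
    rw [QuotientAddGroup.kerLift_mk] at this
    change Θ (φA a + φB 0) = θ' (a, 0) at this
    rw [map_zero, add_zero] at this
    rw [this]
    change toDual x (φB 0) = 0
    rw [map_zero, map_zero]
  have hΘB : ∀ b, Θ (φB b) = toDual x (φB b) := by
    intro b
    have := hΘ (QuotientAddGroup.mk (0, b))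
    rw [QuotientAddGroup.kerLift_mk] at this
    change Θ (φA 0 + φB b) = θ' (0, b) at this
    rw [map_zero, zero_add] at this
    rw [this]
    rfl
  obtain ⟨x₁, hx₁⟩ := hS.bijective.2 Θ
  rw [Submodule.mem_sup]
  refine ⟨x₁, ?_, x - x₁, ?_, add_sub_cancel x₁ x⟩
  · rw [mem_ker_transpose_iff hA hπA]
    intro a
    rw [hx₁, hΘA]
  · rw [mem_ker_transpose_iff hB hπB]
    intro b
    rw [map_sub, AddMonoidHom.sub_apply, hx₁, hΘB, sub_self]

/-- **(E2) The residual annihilator**: if `toDual x` kills the `p`-torsion of a subgroup `C ≤ S`, then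
`x ≡ p • y` modulo the annihilator of `C` for some `y` (write `toDual x|_C = p · θ` with `θ` a character of `C`
extending `p c ↦ toDual x c`, and extend `θ` to `S`). [folklore] -/
theorem exists_sub_nsmul_forall_eq_zero (hS : IsDualPair p ψ toDual) (C : AddSubgroup S) (x : X)
    (hx : ∀ c ∈ C, p • c = 0 → toDual x c = 0) :
    ∃ y : X, ∀ c ∈ C, toDual (x - p • y) c = 0 := by
  -- multiplication by `p` on `C`, its kernel `C[p]`
  let mulp : C →+ C := DistribSMul.toAddMonoidHom C p
  let χ : C →+ AddCircle (1 : ℚ) := (toDual x).comp C.subtype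
  have hχ : mulp.ker ≤ χ.ker := by
    intro c hc
    rw [AddMonoidHom.mem_ker] at hc ⊢
    exact hx c c.2 (by exact_mod_cast congrArg Subtype.val hc)
  let θ₀ : C ⧸ mulp.ker →+ AddCircle (1 : ℚ) := QuotientAddGroup.lift mulp.ker χ hχ
  obtain ⟨θ, hθ⟩ := exists_character_extend (QuotientAddGroup.kerLift mulp) (QuotientAddGroup.kerLift_injective mulp) θ₀
  -- `θ (p • c) = toDual x c`
  have hθ' : ∀ c : C, θ (p • c) = toDual x c := by
    intro c
    have := hθ (QuotientAddGroup.mk c)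
    rw [QuotientAddGroup.kerLift_mk] at this
    exact this
  obtain ⟨Θ, hΘ⟩ := exists_character_extend C.subtype C.subtype_injective θ
  obtain ⟨y, hy⟩ := hS.bijective.2 Θ
  refine ⟨y, fun c hc ↦ ?_⟩
  rw [map_sub, AddMonoidHom.sub_apply, nsmul_eval, hy, sub_eq_zero]
  have h1 := hΘ (p • ⟨c, hc⟩)
  have h2 := hθ' ⟨c, hc⟩
  rw [h2] at h1
  rw [← h1]
  rfl

/-- **(E2, finiteness) The residual annihilator quotient is finite.** For subgroups cut out inside `S` by a
predicate `C` (a subgroup) whose `p`-torsion is finite: the quotient of `X` by `{x | toDual x kills C} + pX`…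
stated as: the quotient of `X` by any submodule containing every `x` with `toDual x|_{C[p]} = 0` is finite.
[folklore] -/
theorem finite_quot_of_forall_mem (C : AddSubgroup S) (hC : Set.Finite {s : S | s ∈ C ∧ p • s = 0})
    (N : Submodule (PowerSeries ℤ_[p]) X)
    (hN : ∀ x : X, (∀ c ∈ C, p • c = 0 → toDual x c = 0) → x ∈ N) : Finite (X ⧸ N) := by
  -- `Φ x := (toDual x c)_{c ∈ C[p]}` has finite image (values in the `p`-torsion of `ℚ/ℤ`) and `ker Φ ≤ N`
  set Cp : Set S := {s : S | s ∈ C ∧ p • s = 0} with hCp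
  haveI : Finite Cp := hC.to_subtype
  have hT : {u : AddCircle (1 : ℚ) | p • u = 0}.Finite := AddCircle.finite_torsion (1 : ℚ) (Fact.out : p.Prime).pos
  let Φ : X →+ (Cp → AddCircle (1 : ℚ)) :=
    { toFun := fun x c ↦ toDual x c.1
      map_zero' := by ext c; simp
      map_add' := fun x y ↦ by ext c; simp }
  have hΦ : ∀ (x : X) (c : Cp), Φ x c = toDual x c.1 := fun _ _ ↦ rfl
  have hker : ∀ x, Φ x = 0 → x ∈ N := by
    intro x hx
    refine hN x fun c hc hpc ↦ ?_
    rw [← hΦ x ⟨c, hc, hpc⟩, hx, Pi.zero_apply]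
  -- the range of `Φ` is finite: it lies in the finite set of `p`-torsion-valued functions
  have hrange : (Φ.range : Set (Cp → AddCircle (1 : ℚ))).Finite := by
    refine (Set.Finite.pi (t := fun _ : Cp ↦ {u : AddCircle (1 : ℚ) | p • u = 0}) fun _ ↦ hT).subset ?_
    rintro f ⟨x, rfl⟩
    simp only [Set.mem_pi, Set.mem_univ, Set.mem_setOf_eq, forall_const]
    intro c
    rw [hΦ, ← map_nsmul, c.2.2, map_zero]
  haveI : Finite Φ.range := hrange.to_subtype
  -- `X/N` is a quotient of `X/ker Φ ≃ range Φ`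
  haveI : Finite (X ⧸ Φ.ker) := Finite.of_equiv _ (QuotientAddGroup.quotientKerEquivRange Φ).symm.toEquiv
  refine Finite.of_surjective (QuotientAddGroup.lift Φ.ker N.mkQ.toAddMonoidHom fun x hx ↦ ?_) ?_
  · rw [AddMonoidHom.mem_ker] at hx
    change N.mkQ x = 0
    rw [Submodule.mkQ_apply, Submodule.Quotient.mk_eq_zero]
    exact hker x hx
  · intro z
    obtain ⟨x, rfl⟩ := Submodule.mkQ_surjective N z
    exact ⟨QuotientAddGroup.mk x, rfl⟩

/-- **THE RESIDUAL DICHOTOMY.** Let `(X, S)` be a dual pair and `(XA, SA)`, `(XB, SB)` dual pairs mapping INTO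
it by injective equivariant `φA`, `φB` (so `XA`, `XB` are quotients of `X`). If `ℓ_𝔭(X/(p)X) ≤ 1` at `𝔭 = (p)`
("residual corank of `S` at most one") and the `p`-torsion of `φA(SA) ∩ φB(SB)` is finite, then `ℓ_𝔭(XA) = 0` or
`ℓ_𝔭(XB) = 0` (one of the two sub-pairs has `μ = 0`). The count:
`ℓ(X/U') + ℓ(X/V') = ℓ(X/(U' ⊓ V')) + ℓ(X/(U' ⊔ V')) ≤ ℓ(X/pX) + 0 ≤ 1` for `U' = ann(A) + pX`,
`V' = ann(B) + pX`, using (E1) `ann(A ∩ B) = ann(A) + ann(B)` and (E2). [folklore] -/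
theorem lengthAt_eq_zero_or_of_residual (hS : IsDualPair p ψ toDual) (hA : IsDualPair p ψA toDualA)
    (hB : IsDualPair p ψB toDualB) (φA : SA →+ S) (hφA : ∀ a, φA (ψA a) = ψ (φA a))
    (hφAi : Function.Injective φA) (φB : SB →+ S) (hφB : ∀ b, φB (ψB b) = ψ (φB b))
    (hφBi : Function.Injective φB) [Module.Finite (IwasawaAlgebra p) XA] [Module.Finite (IwasawaAlgebra p) XB]
    (𝔭 : PrimeSpectrum (IwasawaAlgebra p)) (h𝔭 : 𝔭.asIdeal = augIdealP p)
    (h1 : lengthAt (IwasawaAlgebra p) (X ⧸ (augIdealP p • (⊤ : Submodule (IwasawaAlgebra p) X))) 𝔭 ≤ 1)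
    (h2 : Set.Finite {s : S | s ∈ φA.range ⊓ φB.range ∧ p • s = 0}) :
    lengthAt (IwasawaAlgebra p) XA 𝔭 = 0 ∨ lengthAt (IwasawaAlgebra p) XB 𝔭 = 0 := by
  obtain ⟨πA, hπAs, hπA⟩ := hS.exists_linearMap_comp_surjective hA φA hφA hφAi
  obtain ⟨πB, hπBs, hπB⟩ := hS.exists_linearMap_comp_surjective hB φB hφB hφBi
  set I := augIdealP p with hI
  set PX : Submodule (IwasawaAlgebra p) X := I • ⊤ with hPX
  set U' := LinearMap.ker πA ⊔ PX with hU'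
  set V' := LinearMap.ker πB ⊔ PX with hV'
  -- (E1) + (E2): `X/(U' ⊔ V')` is finite
  have hfin : Finite (X ⧸ (U' ⊔ V')) := by
    refine finite_quot_of_forall_mem (toDual := toDual) (φA.range ⊓ φB.range) h2 (U' ⊔ V') fun x hx ↦ ?_
    obtain ⟨y, hy⟩ := exists_sub_nsmul_forall_eq_zero hS (φA.range ⊓ φB.range) x hx
    have hxy : x - p • y ∈ LinearMap.ker πA ⊔ LinearMap.ker πB :=
      mem_sup_ker_of_forall_inf hS hA hB hπA hπB (x - p • y) fun s hsA hsB ↦ hy s ⟨hsA, hsB⟩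
    have hpy : p • y ∈ PX := by
      rw [hPX, ← Nat.cast_smul_eq_nsmul (IwasawaAlgebra p), ← map_natCast (PowerSeries.C (R := ℤ_[p])) p]
      exact Submodule.smul_mem_smul (Ideal.mem_span_singleton_self _) Submodule.mem_top
    have : x = (x - p • y) + p • y := (sub_add_cancel x _).symm
    rw [this]
    have hle : LinearMap.ker πA ⊔ LinearMap.ker πB ≤ U' ⊔ V' := sup_le_sup le_sup_left le_sup_left
    exact Submodule.add_mem _ (hle hxy) ((le_sup_right.trans le_sup_left : PX ≤ U' ⊔ V') hpy)
  have h0 : lengthAt (IwasawaAlgebra p) (X ⧸ (U' ⊔ V')) 𝔭 = 0 := lengthAt_eq_zero_of_finite' _ 𝔭 h𝔭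
  -- the count
  have hcount := lengthAt_quot_inf_add_lengthAt_quot_sup U' V' 𝔭
  have hinf : lengthAt (IwasawaAlgebra p) (X ⧸ (U' ⊓ V')) 𝔭 ≤ 1 :=
    (lengthAt_quot_le_of_le (le_inf le_sup_right le_sup_right : PX ≤ U' ⊓ V') 𝔭).trans h1
  rw [h0, add_zero] at hcount
  -- `ℓ(X/U') = ℓ(XA/pXA)`, `ℓ(X/V') = ℓ(XB/pXB)`
  have hUA := lengthAt_quot_smul_top_eq_of_surjective I πA hπAs 𝔭
  have hVB := lengthAt_quot_smul_top_eq_of_surjective I πB hπBs 𝔭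
  rw [← hU'] at hUA
  rw [← hV'] at hVB
  rw [← hUA, ← hVB] at hcount
  -- one of the two residual lengths vanishes
  by_contra hne
  rw [not_or] at hne
  obtain ⟨hA0, hB0⟩ := hne
  have hA1 : 1 ≤ lengthAt (IwasawaAlgebra p) (XA ⧸ (I • (⊤ : Submodule (IwasawaAlgebra p) XA))) 𝔭 := by
    rw [Order.one_le_iff_ne_zero]
    exact fun h ↦ hA0 (lengthAt_eq_zero_of_lengthAt_quot_eq_zero XA 𝔭 h𝔭 h)
  have hB1 : 1 ≤ lengthAt (IwasawaAlgebra p) (XB ⧸ (I • (⊤ : Submodule (IwasawaAlgebra p) XB))) 𝔭 := by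
    rw [Order.one_le_iff_ne_zero]
    exact fun h ↦ hB0 (lengthAt_eq_zero_of_lengthAt_quot_eq_zero XB 𝔭 h𝔭 h)
  have h11 : (1 : ℕ∞) + 1 ≤ 1 := by
    calc (1 : ℕ∞) + 1 ≤ _ := add_le_add hA1 hB1
      _ = _ := hcount.symm
      _ ≤ 1 := hinf
  exact absurd h11 (by decide)

/-- **`S[p]` finite ⟹ `X/(p)X` finite** for a dual pair `(X, S)`: (E2) with `C = S` — a character killing `S[p]` is
`p` times a character. [cite: GreenbergLNM1716, §1 p. 60] [cite: LimSujatha2018, §3 (before Prop. 3.2)] -/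
theorem finite_quot_augIdealP_of_finite_pTorsion (hS : IsDualPair p ψ toDual)
    (hfin : Set.Finite {s : S | p • s = 0}) :
    Finite (X ⧸ (augIdealP p • (⊤ : Submodule (IwasawaAlgebra p) X))) := by
  refine finite_quot_of_forall_mem (toDual := toDual) (⊤ : AddSubgroup S) (by simpa using hfin) _ fun x hx ↦ ?_
  obtain ⟨y, hy⟩ := exists_sub_nsmul_forall_eq_zero hS ⊤ x fun c _ hc ↦ hx c trivial hc
  have hxy : x - p • y = 0 := by
    apply hS.bijective.1
    rw [map_zero]
    ext c
    exact hy c trivial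
  rw [sub_eq_zero] at hxy
  rw [hxy, ← Nat.cast_smul_eq_nsmul (IwasawaAlgebra p), ← map_natCast (PowerSeries.C (R := ℤ_[p])) p]
  exact Submodule.smul_mem_smul (Ideal.mem_span_singleton_self _) Submodule.mem_top

/-- **`X` finitely generated over `ℤ_p` ⟹ `S[p]` finite** for a dual pair `(X, S)`: evaluation at finitely many
`ℤ_p`-generators embeds `S[p]` into a finite product of copies of `(ℚ/ℤ)[p]` (characters separate points).
[cite: LimSujatha2018, §3 (before Prop. 3.2)] [cite: GreenbergLNM1716, §1 p. 60] -/
theorem finite_pTorsion_of_moduleFinite_padicInt (hS : IsDualPair p ψ toDual)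
    (hX : Module.Finite ℤ_[p] (RestrictScalars ℤ_[p] (IwasawaAlgebra p) X)) :
    Set.Finite {s : S | p • s = 0} := by
  obtain ⟨G, hG⟩ := hX
  have hT : {u : AddCircle (1 : ℚ) | p • u = 0}.Finite := AddCircle.finite_torsion (1 : ℚ) (Fact.out : p.Prime).pos
  haveI : Finite {u : AddCircle (1 : ℚ) | p • u = 0} := hT.to_subtype
  let ev : {s : S | p • s = 0} →
      ({x : RestrictScalars ℤ_[p] (IwasawaAlgebra p) X // x ∈ G} → {u : AddCircle (1 : ℚ) | p • u = 0}) :=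
    fun s x ↦ ⟨toDual (show X from (x.1 : RestrictScalars ℤ_[p] (IwasawaAlgebra p) X)) s.1, by
      change p • toDual _ (s.1 : S) = 0
      rw [← map_nsmul, s.2, map_zero]⟩
  refine Set.finite_coe_iff.mp (Finite.of_injective ev fun s s' hss' ↦ ?_)
  have hgen : ∀ x : RestrictScalars ℤ_[p] (IwasawaAlgebra p) X,
      toDual (show X from x) (s.1 : S) = toDual (show X from x) (s'.1 : S) := by
    intro x
    have hx : x ∈ Submodule.span ℤ_[p] (G : Set (RestrictScalars ℤ_[p] (IwasawaAlgebra p) X)) := by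
      rw [hG]; exact Submodule.mem_top
    refine Submodule.span_induction (M := RestrictScalars ℤ_[p] (IwasawaAlgebra p) X)
      (p := fun y _ ↦ toDual (show X from y) (s.1 : S) = toDual (show X from y) (s'.1 : S)) ?_ ?_ ?_ ?_ hx
    · intro y hy
      exact congrArg (fun f ↦ ((f ⟨y, Finset.mem_coe.mp hy⟩ : {u : AddCircle (1 : ℚ) | p • u = 0}) :
        AddCircle (1 : ℚ))) hss'
    · change toDual 0 _ = toDual 0 _
      rw [map_zero, AddMonoidHom.zero_apply, AddMonoidHom.zero_apply]
    · intro y z _ _ hy hz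
      change toDual ((show X from y) + (show X from z)) _ = toDual ((show X from y) + (show X from z)) _
      rw [map_add, AddMonoidHom.add_apply, AddMonoidHom.add_apply, hy, hz]
    · intro c y _ hy
      have e : c • y = (show RestrictScalars ℤ_[p] (IwasawaAlgebra p) X from
          PowerSeries.C c • (show X from y)) := by
        rw [RestrictScalars.smul_def, ← PowerSeries.C_eq_algebraMap]; rfl
      rw [e]
      change toDual (PowerSeries.C c • (show X from y)) _ = toDual (PowerSeries.C c • (show X from y)) _
      have h1 : p ^ 1 • (s.1 : S) = 0 := by rw [pow_one]; exact s.2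
      have h2 : p ^ 1 • (s'.1 : S) = 0 := by rw [pow_one]; exact s'.2
      rw [hS.C_smul c _ _ 1 h1, hS.C_smul c _ _ 1 h2, hy]
  apply Subtype.ext
  by_contra hne
  have hne' : (s.1 : S) - s'.1 ≠ 0 := sub_ne_zero.mpr hne
  obtain ⟨χ, hχ⟩ := CharacterModule.exists_character_apply_ne_zero_of_ne_zero hne'
  obtain ⟨x, hx⟩ := hS.bijective.2 χ
  apply hχ
  rw [← hx, map_sub]
  exact sub_eq_zero.mpr (hgen x)

/-- **`ℓ_{(p)}(X) = 0 ⟹ S[p]` finite** for a dual pair with `X` finitely generated over `Λ`.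
[cite: Washington1997, §13.2] [cite: LimSujatha2018, §3] -/
theorem finite_pTorsion_of_lengthAt_eq_zero (hS : IsDualPair p ψ toDual) [Module.Finite (IwasawaAlgebra p) X]
    (𝔭 : PrimeSpectrum (IwasawaAlgebra p)) (h𝔭 : 𝔭.asIdeal = augIdealP p)
    (h : lengthAt (IwasawaAlgebra p) X 𝔭 = 0) : Set.Finite {s : S | p • s = 0} := by
  letI : Module ℤ_[p] X := Module.compHom X (algebraMap ℤ_[p] (IwasawaAlgebra p))
  haveI : IsScalarTower ℤ_[p] (IwasawaAlgebra p) X := IsScalarTower.of_compHom ℤ_[p] _ X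
  have hfg : Module.Finite ℤ_[p] X := finite_of_lengthAt_eq_zero p X 𝔭 h𝔭 h
  exact finite_pTorsion_of_moduleFinite_padicInt hS hfg

end Dichotomy

end Summit.BirchSwinnertonDyer.BirchSwinnertonDyer.Theorems.SmallImageFinePivot

end
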